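import Mathlib.MeasureTheory.Integral.MeanInequalities
import Literature.Analysis.FluidPDE.HardSphereFlowJointMeasurable
import Literature.Analysis.FluidPDE.HardSphereTrajectoryMeasurable
import Literature.Analysis.FluidPDE.HardSphereTorusMeasure
import Summits.AtomisticToContinuum.HydrodynamicLimit.Theorems.JParityClosureOddContactSymmetryGibbsInvariance
import Summits.AtomisticToContinuum.HydrodynamicLimit.Theses.TwoClocks

/-!
# Window exponential moments are log-subadditive in the window (Hölder + invariance)

Helper file for the support item `TwoClocks.EquilibriumShearWindowLD`
(stmt-AtomisticToContinuum-14446) and, verbatim, for every finite-kinetic-window large-deviation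
item of the sub-problem (`TwoClocks.EquilibriumFastWindowLD` stmt-14440, `KineticWindowLDUniform`
stmt-14442 at constant profiles, `OneFlightGossipEngine.KineticCurrentsWindowLD(Uniform)`,
`FluxGibbsianityLdDrude.KineticFluxLdDecay`): the structural fact quoted in the items' docstrings as
"`Λ_{2τ} ≤ Λ_τ` by Hölder + invariance" / "`τ Λ_τ` is subadditive".

For a hard-sphere flow `Φ` on `𝕋³`, a law `μ` carried by the good set and preserved by `Φ_{w₁}`, a
continuous one-body observable `F` and the window functional
`W_w(z) = Σᵢ w⁻¹ ∫₀ʷ F(Φ_r z i) dr`: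

* `window_integral_add_window` / `windowSum_add_window` — PATHWISE, on the good set:
  `W_{w₁+w₂}(z) = (w₁/(w₁+w₂)) W_{w₁}(z) + (w₂/(w₁+w₂)) W_{w₂}(Φ_{w₁} z)` (additivity of the interval
  integral, the substitution `r = s + w₁`, and the group property `Φ_{s+w₁} = Φ_s ∘ Φ_{w₁}`);
* `lintegral_exp_window_add_le_geomMean` — HÖLDER with exponents `(w₁+w₂)/w₁`, `(w₁+w₂)/w₂` and
  INVARIANCE of `μ` under `Φ_{w₁}`:
  `M(w₁+w₂) ≤ M(w₁)^{w₁/(w₁+w₂)} · M(w₂)^{w₂/(w₁+w₂)}`, `M(w) := ∫ exp(β W_w) dμ` — i.e.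
  `w ↦ w log M(w)` is subadditive;
* `lintegral_exp_window_two_mul_le`, `lintegral_exp_window_nat_mul_le` — hence `M(2w) ≤ M(w)` and
  `M(k w) ≤ M(w)` for every `k ≥ 1`;
* `shearWindowMoment_nat_mul_le` — the instance for the item: under the constant-profile (global)
  Gibbs law `G_N = localGibbsLaw σ a₀ 0 θ₀ N Φ_N` (invariant under every hard-sphere flow,
  `measurePreserving_flow_localGibbsLaw_const`; carried by the good set) the window exponential
  moment of the kinetic shear stress `φ(x) v⁰ v¹` at window `k·τ(N+1)^{-1/3}` is at most the one at
  window `τ(N+1)^{-1/3}`: once the item's bound holds at `(τ, N)` it holds at `(kτ, N)` for all `k`.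

No dynamics beyond the group property and invariance is used; all statements hold for every `N`,
every flow and every window.

References: Olla–Varadhan–Yau, Comm. Math. Phys. 155 (1993) 523, §2 (exponential-moment currency);
H. Spohn, *Large Scale Dynamics of Interacting Particles* (1991), Part I §2.3 (invariance of the
equilibrium measures).

prover-pitem-stmt-AtomisticToContinuum-14446-0.
-/

noncomputable section

open MeasureTheory Real Set
open scoped ENNReal

namespace Summit.AtomisticToContinuum.HydrodynamicLimit.Theorems

open Literature.Analysis.FluidPDE Literature.MathematicalPhysics.KineticTheory

/-! ### Pathwise: concatenation of windows along a good orbit -/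

/-- **Concatenation of windows along a good orbit.** For `z` good and a continuous observable,
`∫₀^{w₁+w₂} F(Φ_r z i) dr = ∫₀^{w₁} F(Φ_r z i) dr + ∫₀^{w₂} F(Φ_s(Φ_{w₁} z) i) ds` (additivity over
adjacent intervals, the substitution `r = s + w₁`, and the group property on the good set).
[folklore] -/
theorem window_integral_add_window {ε : ℝ} {n : ℕ}
    (Φ : HardSphereFlow (Torus.geometry (Fin 3)) ε n) {z : Config n (Fin 3) T3} (hz : z ∈ Φ.good)
    {F : T3 × V3 → ℝ} (hF : Continuous F) (i : Fin n) (w₁ w₂ : ℝ) :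
    ∫ r in (0 : ℝ)..(w₁ + w₂), F (Φ.flow r z i) =
      (∫ r in (0 : ℝ)..w₁, F (Φ.flow r z i)) + ∫ s in (0 : ℝ)..w₂, F (Φ.flow s (Φ.flow w₁ z) i) := by
  -- a continuous observable along a good orbit is interval integrable: the orbit is measurable in time
  -- (`IsHardSphereTrajectory.measurable_torus`) and particle `i` stays in the compact set
  -- `univ ×ˢ closedBall 0 √(2E(z))` (energy conservation), on which `F` is bounded
  -- (twin of `intervalIntegrable_comp_orbit`, `Theorems/OneFlightGossipEngineKineticCurrentsWindowLDSplit`)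
  have hint : ∀ a b : ℝ, IntervalIntegrable (fun r => F (Φ.flow r z i)) volume a b := by
    intro a b
    have hγ : Measurable fun t => Φ.flow t z := (Φ.isTrajectory z hz).measurable_torus
    have hm : Measurable fun r => F (Φ.flow r z i) :=
      hF.measurable.comp ((measurable_pi_apply i).comp hγ)
    set K : Set (T3 × V3) :=
      Set.univ ×ˢ Metric.closedBall (0 : V3) (Real.sqrt (2 * configEnergy z))
    have hK : IsCompact K := isCompact_univ.prod (isCompact_closedBall _ _)
    have hmem : ∀ r, Φ.flow r z i ∈ K := by
      intro r
      refine ⟨Set.mem_univ _, ?_⟩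
      rw [Metric.mem_closedBall, dist_zero_right]
      refine Real.le_sqrt_of_sq_le ?_
      exact (norm_vel_sq_le_two_mul_configEnergy _ i).trans_eq (by rw [Φ.configEnergy_flow hz r])
    obtain ⟨B, hB⟩ := hK.exists_bound_of_continuousOn hF.continuousOn
    exact (intervalIntegrable_const (c := B)).mono_fun' hm.aestronglyMeasurable
      (ae_of_all _ fun r => hB _ (hmem r))
  rw [← intervalIntegral.integral_add_adjacent_intervals (b := w₁) (hint 0 w₁) (hint w₁ (w₁ + w₂))]
  congr 1
  have h : ∀ s, Φ.flow s (Φ.flow w₁ z) = Φ.flow (s + w₁) z := fun s => (Φ.flow_add s w₁ z hz).symm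
  simp_rw [h]
  rw [intervalIntegral.integral_comp_add_right (fun r => F (Φ.flow r z i)) w₁, zero_add, add_comm w₂]

/-- **Concatenation of windows for the window functional** `W_w(z) = Σᵢ w⁻¹ ∫₀ʷ F(Φ_r z i) dr`:
on the good set, `W_{w₁+w₂}(z) = (w₁/(w₁+w₂)) W_{w₁}(z) + (w₂/(w₁+w₂)) W_{w₂}(Φ_{w₁} z)` for
`w₁, w₂ > 0`. [folklore] -/
theorem windowSum_add_window {ε : ℝ} {n : ℕ}
    (Φ : HardSphereFlow (Torus.geometry (Fin 3)) ε n) {z : Config n (Fin 3) T3} (hz : z ∈ Φ.good)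
    {F : T3 × V3 → ℝ} (hF : Continuous F) {w₁ w₂ : ℝ} (hw₁ : 0 < w₁) (hw₂ : 0 < w₂) :
    ∑ i, (w₁ + w₂)⁻¹ * ∫ r in (0 : ℝ)..(w₁ + w₂), F (Φ.flow r z i) =
      w₁ / (w₁ + w₂) * (∑ i, w₁⁻¹ * ∫ r in (0 : ℝ)..w₁, F (Φ.flow r z i)) +
        w₂ / (w₁ + w₂) * ∑ i, w₂⁻¹ * ∫ s in (0 : ℝ)..w₂, F (Φ.flow s (Φ.flow w₁ z) i) := by
  rw [Finset.mul_sum, Finset.mul_sum, ← Finset.sum_add_distrib]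
  refine Finset.sum_congr rfl fun i _ => ?_
  rw [window_integral_add_window Φ hz hF i w₁ w₂]
  have h12 : (w₁ + w₂) ≠ 0 := (add_pos hw₁ hw₂).ne'
  field_simp

/-! ### Hölder + invariance -/

/-- The window functional of a continuous observable is a.e.-measurable for every law carried by the
good set. [folklore] -/
theorem aemeasurable_windowSum {ε : ℝ} {n : ℕ}
    (Φ : HardSphereFlow (Torus.geometry (Fin 3)) ε n) {μ : Measure (Config n (Fin 3) T3)}
    (hμ : μ Φ.goodᶜ = 0) {F : T3 × V3 → ℝ} (hF : Continuous F) (β w : ℝ) :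
    AEMeasurable (fun z => β * ∑ i, w⁻¹ * ∫ r in (0 : ℝ)..w, F (Φ.flow r z i)) μ := by
  refine AEMeasurable.const_mul (Finset.aemeasurable_fun_sum _ fun i _ => ?_) β
  exact (Φ.aemeasurable_intervalIntegral_comp_flow_torus
    (hF.measurable.comp (measurable_pi_apply i)) 0 w hμ).const_mul _

/-- `ofReal (exp (a x)) ^ p = ofReal (exp x)` when `a p = 1`. [folklore] -/
theorem ofReal_exp_mul_rpow {a p : ℝ} (h : a * p = 1) (x : ℝ) :
    ENNReal.ofReal (Real.exp (a * x)) ^ p = ENNReal.ofReal (Real.exp x) := by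
  rw [ENNReal.ofReal_rpow_of_pos (Real.exp_pos _), ← Real.exp_mul, mul_comm a x, mul_assoc, h,
    mul_one]

/-- **Hölder + invariance: window exponential moments are log-subadditive in the window.** For a
hard-sphere flow `Φ` on `𝕋³`, a law `μ` carried by the good set and preserved by `Φ_{w₁}`, a
continuous observable `F`, `β ∈ ℝ` and windows `w₁, w₂ > 0`, with
`M(w) := ∫ exp(β Σᵢ w⁻¹∫₀ʷ F(Φ_r z i) dr) dμ`:
`M(w₁ + w₂) ≤ M(w₁)^{w₁/(w₁+w₂)} · M(w₂)^{w₂/(w₁+w₂)}`.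
Proof: concatenate the windows on the good set (`windowSum_add_window`), apply Hölder with the
conjugate exponents `(w₁+w₂)/w₁`, `(w₁+w₂)/w₂` (`ENNReal.lintegral_mul_le_Lp_mul_Lq`), and restart
the second factor at `Φ_{w₁} z` using the invariance of `μ`. [folklore] -/
theorem lintegral_exp_window_add_le_geomMean {ε : ℝ} {n : ℕ}
    (Φ : HardSphereFlow (Torus.geometry (Fin 3)) ε n) {μ : Measure (Config n (Fin 3) T3)}
    (hμ : μ Φ.goodᶜ = 0) {w₁ w₂ : ℝ} (hw₁ : 0 < w₁) (hw₂ : 0 < w₂)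
    (hinv : MeasurePreserving (Φ.flow w₁) μ μ) {F : T3 × V3 → ℝ} (hF : Continuous F) (β : ℝ) :
    ∫⁻ z, ENNReal.ofReal (Real.exp (β * ∑ i, (w₁ + w₂)⁻¹ *
        ∫ r in (0 : ℝ)..(w₁ + w₂), F (Φ.flow r z i))) ∂μ ≤
      (∫⁻ z, ENNReal.ofReal (Real.exp (β * ∑ i, w₁⁻¹ *
          ∫ r in (0 : ℝ)..w₁, F (Φ.flow r z i))) ∂μ) ^ (w₁ / (w₁ + w₂)) *
        (∫⁻ z, ENNReal.ofReal (Real.exp (β * ∑ i, w₂⁻¹ *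
          ∫ r in (0 : ℝ)..w₂, F (Φ.flow r z i))) ∂μ) ^ (w₂ / (w₁ + w₂)) := by
  have h12 : 0 < w₁ + w₂ := add_pos hw₁ hw₂
  set a : ℝ := w₁ / (w₁ + w₂) with ha
  set b : ℝ := w₂ / (w₁ + w₂) with hb
  have ha0 : 0 < a := div_pos hw₁ h12
  have hb0 : 0 < b := div_pos hw₂ h12
  have hab : a + b = 1 := by rw [ha, hb, ← add_div, div_self h12.ne']
  -- the two window functionals (the second restarted at `Φ_{w₁} z`)
  set W₁ : Config n (Fin 3) T3 → ℝ := fun z => β * ∑ i, w₁⁻¹ * ∫ r in (0 : ℝ)..w₁, F (Φ.flow r z i)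
    with hW₁
  set W₂ : Config n (Fin 3) T3 → ℝ := fun z => β * ∑ i, w₂⁻¹ * ∫ r in (0 : ℝ)..w₂, F (Φ.flow r z i)
    with hW₂
  have hW₁m : AEMeasurable W₁ μ := aemeasurable_windowSum Φ hμ hF β w₁
  have hW₂m : AEMeasurable W₂ μ := aemeasurable_windowSum Φ hμ hF β w₂
  have hW₂m' : AEMeasurable (fun z => W₂ (Φ.flow w₁ z)) μ := by
    have h : AEMeasurable W₂ (μ.map (Φ.flow w₁)) := by rwa [hinv.map_eq]
    exact h.comp_measurable (Φ.measurable_flow w₁)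
  -- pathwise factorisation on the good set
  have hgood : ∀ᵐ z ∂μ, z ∈ Φ.good :=
    (measure_eq_zero_iff_ae_notMem.1 hμ).mono fun z hz => by simpa using hz
  have hae : ∀ᵐ z ∂μ, ENNReal.ofReal (Real.exp (β * ∑ i, (w₁ + w₂)⁻¹ *
      ∫ r in (0 : ℝ)..(w₁ + w₂), F (Φ.flow r z i))) =
      ENNReal.ofReal (Real.exp (a * W₁ z)) * ENNReal.ofReal (Real.exp (b * W₂ (Φ.flow w₁ z))) := by
    filter_upwards [hgood] with z hz
    rw [windowSum_add_window Φ hz hF hw₁ hw₂, ← ENNReal.ofReal_mul (Real.exp_nonneg _),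
      ← Real.exp_add]
    congr 2
    simp only [hW₁, hW₂, ha, hb]
    ring
  rw [lintegral_congr_ae hae]
  -- Hölder with exponents `1/a`, `1/b`
  have hpq : (a⁻¹).HolderConjugate b⁻¹ :=
    { inv_add_inv_eq_inv := by rw [inv_inv, inv_inv, inv_one, hab]
      left_pos := inv_pos.2 ha0
      right_pos := inv_pos.2 hb0 }
  have hf : AEMeasurable (fun z => ENNReal.ofReal (Real.exp (a * W₁ z))) μ :=
    (Real.measurable_exp.comp_aemeasurable (hW₁m.const_mul a)).ennreal_ofReal
  have hg : AEMeasurable (fun z => ENNReal.ofReal (Real.exp (b * W₂ (Φ.flow w₁ z)))) μ :=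
    (Real.measurable_exp.comp_aemeasurable (hW₂m'.const_mul b)).ennreal_ofReal
  have hH := ENNReal.lintegral_mul_le_Lp_mul_Lq μ hpq hf hg
  simp only [Pi.mul_apply, one_div, inv_inv,
    ofReal_exp_mul_rpow (mul_inv_cancel₀ ha0.ne'), ofReal_exp_mul_rpow (mul_inv_cancel₀ hb0.ne')]
    at hH
  -- invariance: restart the second factor at `Φ_{w₁} z`
  have hshift : ∫⁻ z, ENNReal.ofReal (Real.exp (W₂ (Φ.flow w₁ z))) ∂μ =
      ∫⁻ z, ENNReal.ofReal (Real.exp (W₂ z)) ∂μ := by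
    have hm : AEMeasurable (fun z => ENNReal.ofReal (Real.exp (W₂ z))) (μ.map (Φ.flow w₁)) := by
      rw [hinv.map_eq]
      exact (Real.measurable_exp.comp_aemeasurable hW₂m).ennreal_ofReal
    rw [← lintegral_map' hm (Φ.measurable_flow w₁).aemeasurable, hinv.map_eq]
  rw [hshift] at hH
  exact hH

/-- **Doubling the window does not increase the exponential moment**: under the hypotheses of
`lintegral_exp_window_add_le_geomMean` with `w₁ = w₂ = w`, `M(2w) ≤ M(w)`. [folklore] -/
theorem lintegral_exp_window_two_mul_le {ε : ℝ} {n : ℕ}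
    (Φ : HardSphereFlow (Torus.geometry (Fin 3)) ε n) {μ : Measure (Config n (Fin 3) T3)}
    (hμ : μ Φ.goodᶜ = 0) {w : ℝ} (hw : 0 < w) (hinv : MeasurePreserving (Φ.flow w) μ μ)
    {F : T3 × V3 → ℝ} (hF : Continuous F) (β : ℝ) :
    ∫⁻ z, ENNReal.ofReal (Real.exp (β * ∑ i, (2 * w)⁻¹ *
        ∫ r in (0 : ℝ)..(2 * w), F (Φ.flow r z i))) ∂μ ≤
      ∫⁻ z, ENNReal.ofReal (Real.exp (β * ∑ i, w⁻¹ * ∫ r in (0 : ℝ)..w, F (Φ.flow r z i))) ∂μ := by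
  have h := lintegral_exp_window_add_le_geomMean Φ hμ hw hw hinv hF β
  rw [← two_mul, show w / (2 * w) = 1 / 2 by field_simp,
    ← ENNReal.rpow_add_of_nonneg _ _ (by norm_num) (by norm_num),
    show (1 / 2 : ℝ) + 1 / 2 = 1 by norm_num, ENNReal.rpow_one] at h
  exact h

/-- **Multiplying the window by `k ≥ 1` does not increase the exponential moment**: under a law
carried by the good set and preserved by EVERY `Φ_t`, `M(k w) ≤ M(w)` for all `k : ℕ`, `k ≥ 1`
(induction on `k` with `lintegral_exp_window_add_le_geomMean` at `(w, k w)` and monotonicity of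
`x ↦ x^{k/(k+1)}`). [folklore] -/
theorem lintegral_exp_window_nat_mul_le {ε : ℝ} {n : ℕ}
    (Φ : HardSphereFlow (Torus.geometry (Fin 3)) ε n) {μ : Measure (Config n (Fin 3) T3)}
    (hμ : μ Φ.goodᶜ = 0) {w : ℝ} (hw : 0 < w) (hinv : ∀ t, MeasurePreserving (Φ.flow t) μ μ)
    {F : T3 × V3 → ℝ} (hF : Continuous F) (β : ℝ) (k : ℕ) (hk : 1 ≤ k) :
    ∫⁻ z, ENNReal.ofReal (Real.exp (β * ∑ i, ((k : ℝ) * w)⁻¹ *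
        ∫ r in (0 : ℝ)..((k : ℝ) * w), F (Φ.flow r z i))) ∂μ ≤
      ∫⁻ z, ENNReal.ofReal (Real.exp (β * ∑ i, w⁻¹ * ∫ r in (0 : ℝ)..w, F (Φ.flow r z i))) ∂μ := by
  induction k, hk using Nat.le_induction with
  | base => simp
  | succ k hk ih =>
    have hkpos : (0 : ℝ) < k := by exact_mod_cast hk
    have hkw : 0 < (k : ℝ) * w := mul_pos hkpos hw
    have h := lintegral_exp_window_add_le_geomMean Φ hμ hw hkw (hinv w) hF β
    have hsum : w + (k : ℝ) * w = ((k + 1 : ℕ) : ℝ) * w := by push_cast; ring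
    rw [hsum] at h
    refine h.trans ?_
    set M := ∫⁻ z, ENNReal.ofReal (Real.exp (β * ∑ i, w⁻¹ * ∫ r in (0 : ℝ)..w, F (Φ.flow r z i))) ∂μ
    have hexp : w / (((k + 1 : ℕ) : ℝ) * w) + (k : ℝ) * w / (((k + 1 : ℕ) : ℝ) * w) = 1 := by
      rw [← add_div, div_eq_one_iff_eq (mul_pos (by positivity) hw).ne']
      push_cast
      ring
    have hb : 0 ≤ (k : ℝ) * w / (((k + 1 : ℕ) : ℝ) * w) := by positivity
    calc M ^ (w / (((k + 1 : ℕ) : ℝ) * w)) *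
          (∫⁻ z, ENNReal.ofReal (Real.exp (β * ∑ i, ((k : ℝ) * w)⁻¹ *
            ∫ r in (0 : ℝ)..((k : ℝ) * w), F (Φ.flow r z i))) ∂μ) ^ ((k : ℝ) * w / (((k + 1 : ℕ) : ℝ) * w))
        ≤ M ^ (w / (((k + 1 : ℕ) : ℝ) * w)) * M ^ ((k : ℝ) * w / (((k + 1 : ℕ) : ℝ) * w)) :=
          mul_le_mul' le_rfl (ENNReal.rpow_le_rpow ih hb)
      _ = M := by
          rw [← ENNReal.rpow_add_of_nonneg _ _ (by positivity) hb, hexp, ENNReal.rpow_one]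

/-! ### The instance for the item: the kinetic shear stress under the global Gibbs law -/

/-- The constant-profile (global canonical) Gibbs law is carried by the good set of the flow
(it is absolutely continuous with respect to the Liouville measure). [folklore] -/
theorem localGibbsLaw_const_compl_good (σ a₀ θ₀ : ℝ) (u₀ : V3) (N : ℕ)
    (Φ : HardSphereFlow (Torus.geometry (Fin 3)) (hsDiameter σ N) (N + 1)) :
    localGibbsLaw σ (fun _ => a₀) (fun _ => u₀) (fun _ => θ₀) N Φ Φ.goodᶜ = 0 := by
  have h : localGibbsLaw σ (fun _ => a₀) (fun _ => u₀) (fun _ => θ₀) N Φ ≪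
      liouville (Torus.geometry (Fin 3)) (N + 1) (hsDiameter σ N) := by
    unfold localGibbsLaw
    rw [particleLaw_eq]
    exact withDensity_absolutelyContinuous _ _
  exact h Φ.measure_compl_good

/-- **The window exponential moment of the kinetic shear stress is non-increasing along multiples
of the window** (the "`Λ_{kτ} ≤ Λ_τ` by Hölder + invariance" of the docstring of
`TwoClocks.EquilibriumShearWindowLD`, stmt-AtomisticToContinuum-14446, at every fixed `N`): for
the global Gibbs law `G_N = localGibbsLaw σ a₀ 0 θ₀ N Φ_N` (invariant under every hard-sphere flow,
`measurePreserving_flow_localGibbsLaw_const`), every continuous `φ`, every `β`, `τ > 0`, `N` and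
`k ≥ 1`, the exponential moment at window `(kτ)(N+1)^{-1/3}` is at most the one at window
`τ(N+1)^{-1/3}`. In particular the item's inequality at `(τ, N)` propagates to `(kτ, N)`.
[folklore] -/
theorem shearWindowMoment_nat_mul_le (σ a₀ θ₀ : ℝ) (N : ℕ)
    (Φ : HardSphereFlow (Torus.geometry (Fin 3)) (hsDiameter σ N) (N + 1))
    (φ : T3 → ℝ) (hφ : Continuous φ) (β : ℝ) {τ : ℝ} (hτ : 0 < τ) (k : ℕ) (hk : 1 ≤ k) :
    ∫⁻ z, ENNReal.ofReal (Real.exp (β * ∑ i : Fin (N + 1),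
        ((k : ℝ) * τ * ((N : ℝ) + 1) ^ (-(1 / 3 : ℝ)))⁻¹ *
          ∫ r in (0 : ℝ)..((k : ℝ) * τ * ((N : ℝ) + 1) ^ (-(1 / 3 : ℝ))),
            φ (Φ.flow r z i).1 * ((Φ.flow r z i).2 0 * (Φ.flow r z i).2 1)))
        ∂(localGibbsLaw σ (fun _ => a₀) (fun _ => 0) (fun _ => θ₀) N Φ) ≤
      ∫⁻ z, ENNReal.ofReal (Real.exp (β * ∑ i : Fin (N + 1),
        (τ * ((N : ℝ) + 1) ^ (-(1 / 3 : ℝ)))⁻¹ *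
          ∫ r in (0 : ℝ)..(τ * ((N : ℝ) + 1) ^ (-(1 / 3 : ℝ))),
            φ (Φ.flow r z i).1 * ((Φ.flow r z i).2 0 * (Φ.flow r z i).2 1)))
        ∂(localGibbsLaw σ (fun _ => a₀) (fun _ => 0) (fun _ => θ₀) N Φ) := by
  have hw : 0 < τ * ((N : ℝ) + 1) ^ (-(1 / 3 : ℝ)) :=
    mul_pos hτ (Real.rpow_pos_of_pos (by positivity) _)
  have hF : Continuous fun y : T3 × V3 => φ y.1 * (y.2 0 * y.2 1) := by fun_prop
  have h := lintegral_exp_window_nat_mul_le Φ (localGibbsLaw_const_compl_good σ a₀ θ₀ 0 N Φ) hw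
    (measurePreserving_flow_localGibbsLaw_const σ a₀ θ₀ 0 N Φ) hF β k hk
  simpa only [mul_assoc] using h

end Summit.AtomisticToContinuum.HydrodynamicLimit.Theorems

end
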